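import Summits.BirchSwinnertonDyer.BirchSwinnertonDyer.Theorems.ErratumRoadFiveNonSurjCornerKolyZShallow
import Summits.BirchSwinnertonDyer.BirchSwinnertonDyer.Theorems.ClassRecordThreeCornerAtThreeKolyvaginRecord
import HarnessLib

/-!
# Route `ClassRecordThree` (rung K2@3), cruxes `CornerAtThree` (19111) ∕ `CornerAtThreeW` (21420): the Kolyvagin road's certificate input
# Z₃ᶜ («`M_∞ ≤ t`» on the corner frames at `3`) ON THE SHALLOW LOCUS — PRIME-GENERIC, UNCONDITIONAL — and Z₃ᶜ reduced to its DEEP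
# locus; the corner's typed `3`-part from {Z₃ᶜ-deep, J₃ᶜ, (Tw)} (cell `bsd-stepL`, seat `bsd-stepL-corner-p1` g14;
# `--supports stmt-BirchSwinnertonDyer-21420 --as helper`)

WHY THIS FILE. The seat's g2 Kolyvagin road at `3` (`ClassRecordThreeCornerAtThreeKolyvagin{,Record,Leaf}.lean`, p425172 ff.) derives the
corner's typed missing `3`-part `Typed.MissingPPartAt W 3` from three typed inputs on the corner frames {Z₃ᶜ (`∃ M ≤ t, CertificateAt Dt β ι 3 M`,
McCallum's `M_∞ ≤ t`), J₃ᶜ (the Jetchev direction `M_∞ ≥ t`), (Tw)} + published facts (`missingPPartAt_three_of_corner_of_refinedKolyvaginFrames`).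
The seat's g14 file at `p ≥ 5` (`ErratumRoadFiveNonSurjCornerKolyZShallow.lean`, p590794 ∕ p591598) closed the SHALLOW frames of the `p ≥ 5`
twin Zₚᶜ (= item 19946) in the kernel and isolated its DEEP locus. THIS FILE does the same PRIME-GENERICALLY and reads it at `3`:

* §1 **`Koly.exists_certificateAt_le_of_bottom_not_pow_divisible`** — for ANY odd prime `p`, `E[p]` irreducible, `K` imaginary quadratic
  Heegner for the level `N` with `p ∣ N`, any frame `(Dt, β, ι)` with `β² ≡ d_K (mod 4N)`: if every conductor-1 Kolyvagin–Heegner datum's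
  bottom point, read in `E(K)`, is NOT `p^{t+1}`-divisible (`t = ord_p ∏_ℓ c_ℓ(E/ℚ)`), then `∃ M ≤ t, CertificateAt Dt β ι p M` — the
  conductor-1 certificate at depth `t`. UNCONDITIONAL: Darmon 2004 Thm. 3.6 and Shimura reciprocity at conductor 1 are the tree theorems
  `phi_heegnerTau_mem_singularModuliField_holds` ∕ `heegnerPointOfConductor_one_galoisConj_holds`; no-`p`-torsion of `E(K[1])` from
  irreducibility (Gross 4.3 without surjectivity); descent McCallum 5.1.
* §2 **`Koly.exists_certificateAt_le_of_deep`** — the frame-wise reduction: the conclusion at a frame follows from the conclusion UNDER the extra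
  hypothesis «some conductor-1 datum's bottom point lies in `p^{t+1} E(K)`» (the DEEP case).
* §3 **`Three.Koly.cornerKolyZ_three_of_deep`** — Z₃ᶜ in the EXACT frame shape of `missingPPartAt_three_of_corner_of_refinedKolyvaginFrames`
  (`ClassX11b W 3`, `¬ Surj W 3`, `K` imaginary quadratic Heegner for `N_E`, `d_K` odd, `β`, `3 ∤ Dt.c`) follows from its restriction to the
  deep frames (ONE extra binder), unconditionally.
* §4 **`Three.Koly.missingPPartAt_three_of_corner_of_kolyZDeep_of_jetchev_of_cornerTwist`** — g2's class-wide corner theorem with Z₃ᶜ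
  replaced by Z₃ᶜ-deep and with `hrec`, `hD36` DISCHARGED: `Typed.MissingPPartAt W 3` at every (T4″) corner curve from {Z₃ᶜ-deep, J₃ᶜ, (Tw)}
  + {GZ, Kolyvagin, GZK, modularity ×2, Hoffstein–Luo, Mazur, Cha 2005 Rmk. 25 ×2}.

READING (prose, not used): by Gross–Zagier + BSD for `E/K` the shallow frames are those with `Ш(E/K)[3] = 0` (and `3 ∤ c_Manin`) — the
generic frame; the deep frames are where a DERIVED class must certify: Kolyvagin's conjecture proper (refined form `M_∞ ≤ Σ ord₃ c_ℓ`) at a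
non-surjective irreducible image and `3 ∥ N`. No print reaches it (BCGS 2026 Thm. 2: (sur), good `p > 3`; Sweeting v3: `p ∤ N`; Castella 2024
Thm. 1.3: (ram) and `p > 3`). The registered 21420 line r5 keys its (L) conjunct to `Theorems.CornerAtThreeStepL` (anticyclotomic-IMC
currency), not to Z₃ᶜ; this file only records what the Kolyvagin-road alternative would still owe — the deep frames — for the planner.

HONEST FRAMING: four theorems (no definition, no named fact minted, no `sorry`, axioms the standard trio); CONDITIONAL on the displayed
per-frame ∕ class-wide hypotheses (Z₃ᶜ-deep, J₃ᶜ, (Tw) are OPEN; the Cha 2005 structure facts carry the referee flag `Cha05-Rmk25-structure`);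
items 19111 ∕ 21420 do NOT close; BSD is proved for no curve; no census word moves (T7).

References: [McCallumLMS1991] §5 Lemma 5.1 (p. 303), Cor. 5.6 (p. 310); [GrossLMS1991] §4 Lemma 4.3, (4.1); [Darmon2004] Thm. 3.6, Thm. 3.7;
[Cha2005] Thm. 21, Rmk. 25; [Jetchev2008] Conj. 1.3; [BurungaleEtAl2026] Thm. 2 (print status, prose only); tree:
`Theorems/ErratumRoadFiveNonSurjCornerKolyZShallow.lean` (g14), `Theorems/ClassRecordThreeCornerAtThreeKolyvaginRecord.lean` (g2),
`X11b/Three/KolyvaginNonvanishing.lean`, `X11b/Three/KolyvaginLine.lean`, `X11b/RingClassFieldNoTorsionOfIrreducible.lean`.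
-/

set_option autoImplicit false
set_option linter.dupNamespace false

noncomputable section

open scoped Classical NumberField

namespace Summit.BirchSwinnertonDyer.Rank1Residual.X11b.Three.Koly

open WeierstrassCurve NumberField IsDedekindDomain
  Literature.NumberTheory.EllipticCurves Literature.NumberTheory.EllipticCurves.ModularForms
  Literature.NumberTheory.EllipticCurves.Rank1Residual
  Literature.NumberTheory.EllipticCurves.Rank1Residual.Typed
  Summit.BirchSwinnertonDyer.Rank1Residual Summit.BirchSwinnertonDyer.Rank1Residual.X11b

/-! ### §1 The conductor-1 certificate at depth `t`, prime-generic, unconditional -/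

/-- **Kolyvagin certificate `∃ M ≤ t, CertificateAt Dt β ι p M` ON THE SHALLOW LOCUS — any odd prime `p`, UNCONDITIONAL.** For `W/ℚ`
elliptic globally minimal with `E[p]` irreducible (`p` odd), `K` imaginary quadratic satisfying the Heegner hypothesis for the level `N`
with `p ∣ N` (so `p` splits, hence is unramified, in `K`), a frame `(Dt, β, ι)` at level `N` with `4N ∣ β² − d_K`: if every conductor-1
Kolyvagin–Heegner datum `d₁` and every `y ∈ E(K)` over `P_1` satisfy `y ∉ p^{t+1} E(K)`, `t = ord_p ∏_ℓ c_ℓ(E/ℚ)`, then the conductor-1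
certificate at depth `t` exists: the datum by Darmon 2004 Thm. 3.6 (tree theorem `phi_heegnerTau_mem_singularModuliField_holds`), its bottom
point in `E(K)` by Shimura reciprocity (tree theorem `heegnerPointOfConductor_one_galoisConj_holds`), `P_1 ∉ p^{t+1} E(K[1])` by the seat's
`not_pDiv_one_of_not_exists_pow_smul_eq` (no `p`-power torsion in `E(K[1])` under irreducibility), packaged by `certificateAt_of_not_pDiv_one`.
[cite: McCallumLMS1991, §5 Lemma 5.1 (p. 303)] [cite: GrossLMS1991, §4 Lemma 4.3] [cite: Darmon2004, Thm. 3.6 and Thm. 3.7] -/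
theorem exists_certificateAt_le_of_bottom_not_pow_divisible
    {N : ℕ} [NeZero N] (W : WeierstrassCurve ℚ) [W.IsElliptic] [W.IsGloballyMinimal]
    {K : Type} [Field K] [NumberField K] (hK : IsImaginaryQuadratic K)
    {p : ℕ} (hp : p.Prime) (hp2 : p ≠ 2) (hirr : W.HasIrreducibleModPGaloisRep p)
    (hHN : SatisfiesHeegnerHypothesis N K) (hpN : p ∣ N)
    (Dt : ModularParametrizationData W N) (β : ℤ) (ι : K →+* ℂ) (hβ : (4 * (N : ℤ)) ∣ β ^ 2 - NumberField.discr K)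
    (hshallow : ∀ (d₁ : KolyvaginHeegnerData Dt β ι 1) (y : (W.baseChange K).toAffine.Point),
      WeierstrassCurve.Affine.Point.map (W' := W) (algebraMap K (ringClassField K ι 1)).toRatAlgHom y =
        d₁.derivedPoint →
      ¬ ∃ Q : (W.baseChange K).toAffine.Point, ((p ^ (padicValNat p W.tamagawaProduct + 1) : ℕ) : ℤ) • Q = y) :
    ∃ M : ℕ, M ≤ padicValNat p W.tamagawaProduct ∧ CertificateAt Dt β ι p M := by
  obtain ⟨d₁⟩ := exists_kolyvaginHeegnerData_one (phi_heegnerTau_mem_singularModuliField_holds N W K) hK Dt β ι hβ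
  obtain ⟨y, -, hy⟩ := heegnerSystem_exists_isHeegnerPoint_map_eq_derivedPoint_one
    (heegnerPointOfConductor_one_galoisConj_holds N W K) hK hHN d₁
  -- `E(K[1])[p^s] = 0` on the irreducible cell, `p` unramified in `K` since `p ∣ N` and `K` is Heegner for `N`
  have hp1 : ¬ p ∣ 1 := fun h => hp.one_lt.ne' (Nat.dvd_one.mp h)
  set s := padicValNat p W.tamagawaProduct + 1 with hs
  have hbot := NoTorsionIrr.torsionBy_pow_ringClassField_eq_bot_of_hasIrreducibleModPGaloisRep W hK ι one_ne_zero
    hp hp2 hirr (WeierstrassCurve.exists_weilPairing_holds W p)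
    (isUnramifiedIn_of_satisfiesHeegnerHypothesis_of_dvd hK hHN hp hpN) hp1 s
  have htor : ∀ R : (W.baseChange (ringClassField K ι 1)).toAffine.Point, ((p ^ s : ℕ) : ℤ) • R = 0 → R = 0 := by
    intro R hR
    have hmem : R ∈ AddSubgroup.torsionBy (W.baseChange (ringClassField K ι 1)).toAffine.Point ((p ^ s : ℕ) : ℤ) :=
      (Submodule.mem_torsionBy_iff _ R).mpr hR
    rw [hbot] at hmem
    exact hmem
  have hnd : ¬ PDiv d₁ p s := fun hdiv =>
    hshallow d₁ y hy ((pDiv_one_iff_exists_zsmul_eq hK d₁ y hy p s htor).mp hdiv)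
  exact ⟨padicValNat p W.tamagawaProduct, le_rfl, certificateAt_of_not_pDiv_one d₁ hnd⟩

/-! ### §2 Frame-wise reduction to the deep case -/

/-- **Frame-wise reduction to the DEEP case.** Under the hypotheses of §1 except `hshallow`: if the conclusion `∃ M ≤ t, CertificateAt Dt β ι p M`
is known UNDER the extra hypothesis that some conductor-1 datum's bottom point lies in `p^{t+1} E(K)` (the deep case), then it holds outright
(§1 covers the shallow case). [cite: McCallumLMS1991, §5 (p. 303), Cor. 5.6 (p. 310)] -/
theorem exists_certificateAt_le_of_deep
    {N : ℕ} [NeZero N] (W : WeierstrassCurve ℚ) [W.IsElliptic] [W.IsGloballyMinimal]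
    {K : Type} [Field K] [NumberField K] (hK : IsImaginaryQuadratic K)
    {p : ℕ} (hp : p.Prime) (hp2 : p ≠ 2) (hirr : W.HasIrreducibleModPGaloisRep p)
    (hHN : SatisfiesHeegnerHypothesis N K) (hpN : p ∣ N)
    (Dt : ModularParametrizationData W N) (β : ℤ) (ι : K →+* ℂ) (hβ : (4 * (N : ℤ)) ∣ β ^ 2 - NumberField.discr K)
    (hdeep : (∃ (d₁ : KolyvaginHeegnerData Dt β ι 1) (y : (W.baseChange K).toAffine.Point),
      WeierstrassCurve.Affine.Point.map (W' := W) (algebraMap K (ringClassField K ι 1)).toRatAlgHom y =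
        d₁.derivedPoint ∧
      ∃ Q : (W.baseChange K).toAffine.Point, ((p ^ (padicValNat p W.tamagawaProduct + 1) : ℕ) : ℤ) • Q = y) →
      ∃ M : ℕ, M ≤ padicValNat p W.tamagawaProduct ∧ CertificateAt Dt β ι p M) :
    ∃ M : ℕ, M ≤ padicValNat p W.tamagawaProduct ∧ CertificateAt Dt β ι p M := by
  by_cases h : ∃ (d₁ : KolyvaginHeegnerData Dt β ι 1) (y : (W.baseChange K).toAffine.Point),
      WeierstrassCurve.Affine.Point.map (W' := W) (algebraMap K (ringClassField K ι 1)).toRatAlgHom y =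
        d₁.derivedPoint ∧
      ∃ Q : (W.baseChange K).toAffine.Point, ((p ^ (padicValNat p W.tamagawaProduct + 1) : ℕ) : ℤ) • Q = y
  · exact hdeep h
  · push Not at h
    exact exists_certificateAt_le_of_bottom_not_pow_divisible W hK hp hp2 hirr hHN hpN Dt β ι hβ
      (fun d₁ y hy hQ => by obtain ⟨Q, hQ⟩ := hQ; exact h d₁ y hy Q hQ)

/-! ### §3 Z₃ᶜ from its deep locus -/

/-- **Z₃ᶜ (the corner's Kolyvagin certificates at `3`, in the frame shape of `missingPPartAt_three_of_corner_of_refinedKolyvaginFrames`) FROM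
ITS DEEP LOCUS ALONE.** At every (T4″) corner curve (`(E,3) ∈` X11b, `ρ̄_{E,3}` not onto) and every frame (`K` imaginary quadratic Heegner
for `N_E`, `d_K` odd, `4N_E ∣ β² − d_K`, `3 ∤ Dt.c`): if `∃ M ≤ t, CertificateAt Dt β ι 3 M` (`t = ord₃ ∏ c_ℓ`) holds at the DEEP frames
(extra binder: a conductor-1 datum whose bottom point lies in `3^{t+1} E(K)`), it holds at all frames — unconditionally (§2; `3 ∣ N_E` from
`Mult W 3`, irreducibility from X11b). [cite: McCallumLMS1991, §5 (p. 303), Cor. 5.6 (p. 310)] [cite: Darmon2004, Thm. 3.6 and Thm. 3.7] -/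
theorem cornerKolyZ_three_of_deep
    (hZdeep : ∀ (W : WeierstrassCurve ℚ) [W.IsElliptic] [W.IsGloballyMinimal] [NeZero (W.conductorNorm ℤ)]
      (K : Type) [Field K] [NumberField K]
      (Dt : ModularParametrizationData W (W.conductorNorm ℤ)) (β : ℤ) (ι : K →+* ℂ),
      ClassX11b W 3 → ¬ Surj W 3 →
      IsImaginaryQuadratic K → SatisfiesHeegnerHypothesis (W.conductorNorm ℤ) K →
      Odd (NumberField.discr K) →
      (4 * (W.conductorNorm ℤ : ℤ)) ∣ β ^ 2 - NumberField.discr K → ¬ (3 : ℤ) ∣ Dt.c →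
      (∃ (d₁ : KolyvaginHeegnerData Dt β ι 1) (y : (W.baseChange K).toAffine.Point),
        WeierstrassCurve.Affine.Point.map (W' := W) (algebraMap K (ringClassField K ι 1)).toRatAlgHom y =
          d₁.derivedPoint ∧
        ∃ Q : (W.baseChange K).toAffine.Point, ((3 ^ (padicValNat 3 W.tamagawaProduct + 1) : ℕ) : ℤ) • Q = y) →
      ∃ M : ℕ, M ≤ padicValNat 3 W.tamagawaProduct ∧ CertificateAt Dt β ι 3 M) :
    ∀ (W : WeierstrassCurve ℚ) [W.IsElliptic] [W.IsGloballyMinimal] [NeZero (W.conductorNorm ℤ)]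
      (K : Type) [Field K] [NumberField K]
      (Dt : ModularParametrizationData W (W.conductorNorm ℤ)) (β : ℤ) (ι : K →+* ℂ),
      ClassX11b W 3 → ¬ Surj W 3 →
      IsImaginaryQuadratic K → SatisfiesHeegnerHypothesis (W.conductorNorm ℤ) K →
      Odd (NumberField.discr K) →
      (4 * (W.conductorNorm ℤ : ℤ)) ∣ β ^ 2 - NumberField.discr K → ¬ (3 : ℤ) ∣ Dt.c →
      ∃ M : ℕ, M ≤ padicValNat 3 W.tamagawaProduct ∧ CertificateAt Dt β ι 3 M := by
  intro W _ _ _ K _ _ Dt β ι hX hns hK hHN hodd hβ hc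
  obtain ⟨_, _, hmult, hirr⟩ := id hX
  have hp : (3 : ℕ).Prime := Nat.prime_three
  haveI : Fact (3 : ℕ).Prime := ⟨hp⟩
  have h3N : 3 ∣ W.conductorNorm ℤ :=
    (W.dvd_conductorNorm_iff_not_hasGoodReductionAtPrime 3).mpr
      (WeierstrassCurve.HasMultiplicativeReduction.not_hasGoodReduction (R := ℤ_[3]) hmult)
  exact exists_certificateAt_le_of_deep W hK hp (by norm_num) hirr hHN h3N Dt β ι hβ
    (hZdeep W K Dt β ι hX hns hK hHN hodd hβ hc)

/-! ### §4 The corner's typed `3`-part from {Z₃ᶜ-deep, J₃ᶜ, (Tw)} -/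

/-- **The (T4″) corner's typed missing `3`-part from Z₃ᶜ at the DEEP frames only, the Jetchev direction J₃ᶜ and (Tw)** — g2's
`missingPPartAt_three_of_corner_of_refinedKolyvaginFrames` with (i) Z₃ᶜ replaced by its deep-locus restriction `hZdeep` (§3) and (ii) the two
named inputs Shimura reciprocity at conductor 1 (`hrec`) and Darmon 2004 Thm. 3.6 (`hD36`) DISCHARGED by the tree theorems
`heegnerPointOfConductor_one_galoisConj_holds` ∕ `phi_heegnerTau_mem_singularModuliField_holds`. Remaining named facts: Gross–Zagier,
Kolyvagin, GZK, modularity (`hasEntireLFunction_rat`, `exists_isNewformOf`), Hoffstein–Luo, Mazur 1978 Cor. 4.1, Cha 2005 Rmk. 25 ×2 (flag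
`Cha05-Rmk25-structure`). CONDITIONAL on every binder; 19111 ∕ 21420 NOT closed; nothing booked; T7.
[cite: Cha2005, Thm. 21 and Rmk. 25 (pp. 173–175)] [cite: McCallumLMS1991, §5 Cor. 5.6 (p. 310)] [cite: Jetchev2008, Conj. 1.3]
[cite: Miller2011LMS, Def. 1.1] -/
theorem missingPPartAt_three_of_corner_of_kolyZDeep_of_jetchev_of_cornerTwist
    (hGZ : ∀ (N : ℕ) [NeZero N] (W : WeierstrassCurve ℚ) (K : Type) [Field K] [NumberField K],
      gross_zagier N W K)
    (hKo : ∀ (N : ℕ) [NeZero N] (W : WeierstrassCurve ℚ) (K : Type) [Field K] [NumberField K],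
      kolyvagin N W K)
    (hGZK : rank_eq_analyticRank_of_analyticRank_le_one) (hmod : hasEntireLFunction_rat)
    (hnf : exists_isNewformOf) (hHL : HoffsteinLuo1997_exists_twist_L_one_ne_zero)
    (hMaz : mazur_not_dvd_maninConstant_of_odd)
    (hChaL : Cha2005.rmk25_pow_dvd_card_sha_primary_of_certificate)
    (hChaU : Cha2005.rmk25_padicValNat_card_sha_primary_add_le_of_globalDivisibility)
    -- Z₃ᶜ on the DEEP corner frames of the class only
    (hZdeep : ∀ (W : WeierstrassCurve ℚ) [W.IsElliptic] [W.IsGloballyMinimal] [NeZero (W.conductorNorm ℤ)]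
      (K : Type) [Field K] [NumberField K]
      (Dt : ModularParametrizationData W (W.conductorNorm ℤ)) (β : ℤ) (ι : K →+* ℂ),
      ClassX11b W 3 → ¬ Surj W 3 →
      IsImaginaryQuadratic K → SatisfiesHeegnerHypothesis (W.conductorNorm ℤ) K →
      Odd (NumberField.discr K) →
      (4 * (W.conductorNorm ℤ : ℤ)) ∣ β ^ 2 - NumberField.discr K → ¬ (3 : ℤ) ∣ Dt.c →
      (∃ (d₁ : KolyvaginHeegnerData Dt β ι 1) (y : (W.baseChange K).toAffine.Point),
        WeierstrassCurve.Affine.Point.map (W' := W) (algebraMap K (ringClassField K ι 1)).toRatAlgHom y =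
          d₁.derivedPoint ∧
        ∃ Q : (W.baseChange K).toAffine.Point, ((3 ^ (padicValNat 3 W.tamagawaProduct + 1) : ℕ) : ℤ) • Q = y) →
      ∃ M : ℕ, M ≤ padicValNat 3 W.tamagawaProduct ∧ CertificateAt Dt β ι 3 M)
    -- J₃ᶜ on every corner frame of the class
    (hJ : ∀ (W : WeierstrassCurve ℚ) [W.IsElliptic] [W.IsGloballyMinimal] [NeZero (W.conductorNorm ℤ)]
      (K : Type) [Field K] [NumberField K]
      (Dt : ModularParametrizationData W (W.conductorNorm ℤ)) (β : ℤ) (ι : K →+* ℂ),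
      ClassX11b W 3 → ¬ Surj W 3 →
      IsImaginaryQuadratic K → SatisfiesHeegnerHypothesis (W.conductorNorm ℤ) K →
      Odd (NumberField.discr K) →
      (4 * (W.conductorNorm ℤ : ℤ)) ∣ β ^ 2 - NumberField.discr K → ¬ (3 : ℤ) ∣ Dt.c →
      ∀ (s : ℕ), s ≤ padicValNat 3 W.tamagawaProduct →
        ∀ (n : ℕ) (d : KolyvaginHeegnerData Dt β ι n), Squarefree n →
          (∀ ℓ ∈ n.primeFactors, Zhang2014.IsKolyvaginPrime (W.conductorNorm ℤ) W K 3 ℓ ∧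
            s ≤ Zhang2014.kolyvaginIndex W 3 ℓ) → PDiv d 3 s)
    -- (Tw) by name
    (hCT : ∀ (W : WeierstrassCurve ℚ) [W.IsElliptic] [W.IsGloballyMinimal], CornerTwistAt W) :
    ∀ (W : WeierstrassCurve ℚ) [W.IsElliptic] [W.IsGloballyMinimal],
      ClassX11b W 3 → ¬ Surj W 3 → Typed.MissingPPartAt W 3 :=
  missingPPartAt_three_of_corner_of_refinedKolyvaginFrames hGZ hKo hGZK hmod hnf hHL hMaz
    (fun N _ W K _ _ => heegnerPointOfConductor_one_galoisConj_holds N W K)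
    (fun N _ W K _ _ => phi_heegnerTau_mem_singularModuliField_holds N W K) hChaL hChaU
    (cornerKolyZ_three_of_deep hZdeep) hJ hCT

end Summit.BirchSwinnertonDyer.Rank1Residual.X11b.Three.Koly

end
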